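import Literature.NumberTheory.EllipticCurves.SkinnerUrban2014.ShapiroSelmerBigRep
import Literature.NumberTheory.EllipticCurves.Castella2018.SigmaSelmerUnramifiedOutsideS
import HarnessLib

/-!
# Route `ErratumRoadFive` (rung K2, `p ≥ 5`), crux `IMCDivAtErratumDataAllR` (item stmt-BirchSwinnertonDyer-20169), stub
# S_Fitt: the input `hF1` of the member-congruence assembly — `X^Σ_ac(E[p^∞]) ≃ₗ[Λ] XBig` from Shapiro (SU14 Prop. 3.2.3)
# and the `Σ`-bridge, for the `K̄`-points representation `(W.baseChange K).primaryTorsionGaloisRep p`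

Cell `bsd-stepL` (run/shared/lean/pub/bsd-stepL/), seat `bsd-stepL-imc-p1` (prover g9, 2026-08-27); `--supports
stmt-BirchSwinnertonDyer-20169 --as helper`; Theses-free (imports only the two Literature fact files). INSTANTIATION (I1) of `RoadFFMember.nonempty_memberCongruence`
(p502247): its hypothesis `hF1 : Nonempty (X ≃ₗ[Λ] XBig κ ρ 𝔮 Σ)` for `X = AcSelmer.XAc (W⁄K) p κ 𝔮 Σ γ` and
`ρ = (W.baseChange K).primaryTorsionGaloisRep p`, from the two Literature named facts
`SkinnerUrban2014.prop323_XAc_equiv_XBigDecomp` (F1, Shapiro: `XAc ≃ₗ[Λ] XBigDecomp`, [SU14, Prop. 3.2.3]) and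
`Castella2018.selmerBig_eq_selmerBigDecomp_of_unramifiedOutside` (`Σ`-bridge: `selmerBig = selmerBigDecomp` when `Σ`
contains the ramification away from `p`, [Cas18, proof of Thm. 2.6]). The Summit object `X11b.AcSelmer.XAc` is the
Literature one (same term). THEOREMS ONLY; CONDITIONAL on the two named facts; nothing booked.

References: [SkinnerUrban2014] Prop. 3.2.3; [Castella2018] Def. 2.2, proof of Thm. 2.6; [Castella2018Erratum] §2, Lemma 2.1.
-/

set_option autoImplicit false

noncomputable section

open scoped TensorProduct

open CategoryTheory PowerSeries NumberField IsDedekindDomain Field WeierstrassCurve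
open Literature.NumberTheory.GaloisRepresentations Literature.NumberTheory.EllipticCurves
  Literature.NumberTheory.EllipticCurves.BigGaloisRep Literature.NumberTheory.EllipticCurves.Rank1Residual
  Literature.NumberTheory.EllipticCurves.Castella2018

namespace Summit.BirchSwinnertonDyer.Rank1Residual.X11b.RoadFFMember

variable (W : WeierstrassCurve ℚ) [W.IsElliptic] (p : ℕ) [Fact p.Prime]
  (K : Type) [Field K] [NumberField K]

/-- **`hF1`: `X^Σ_ac(E[p^∞]) ≃ₗ[Λ] XBig κ ρ_E 𝔮 Σ`** for `ρ_E = (W.baseChange K).primaryTorsionGaloisRep p`, from Shapiro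
(`prop323_XAc_equiv_XBigDecomp`: `XAc ≃ₗ[Λ] XBigDecomp`) and the `Σ`-bridge (`selmerBig = selmerBigDecomp`; `XBig`,
`XBigDecomp` are the character modules of these equal submodules). Hypotheses = the union of the two facts' binders
(`5 ≤ p`, `E[p]` irreducible, `K` imaginary quadratic with `p` split, `𝔮 ∋ p`, `Σ` finite away from `p` and containing the
ramification of `E[p^∞]|_{Γ_K}` away from `p`, `κ` anticyclotomic). CONDITIONAL on the two named facts.
[cite: SkinnerUrban2014, Prop. 3.2.3] [cite: Castella2018, proof of Thm. 2.6 (the `Σ`-identification)] -/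
theorem nonempty_XAc_equiv_XBig (hSh : SkinnerUrban2014.prop323_XAc_equiv_XBigDecomp)
    (hSig : selmerBig_eq_selmerBigDecomp_of_unramifiedOutside)
    (hp : 5 ≤ p) (hirr : Irr W p) (hK : IsImaginaryQuadratic K) (hsplit : SatisfiesHeegnerHypothesis p K)
    (𝔮 : HeightOneSpectrum (𝓞 K)) (h𝔮 : ((p : ℕ) : 𝓞 K) ∈ 𝔮.asIdeal)
    (S : Set (HeightOneSpectrum (𝓞 K))) (hS : S.Finite) (hSp : ∀ w ∈ S, ((p : ℕ) : 𝓞 K) ∉ w.asIdeal)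
    (hram : ∀ w : HeightOneSpectrum (𝓞 K), w ∉ S → ((p : ℕ) : 𝓞 K) ∉ w.asIdeal →
      ∀ (σ : LocalGroup K (Sum.inr w)) (P : PrimaryTorsion (geomPoints (W.baseChange K)) p),
        (W.baseChange K).primaryTorsionGaloisRep p (localMap K (Sum.inr w) σ) P = P)
    (κ : ZpExtension K p) (hκ : κ.IsAnticyclotomic) (γ : absoluteGaloisGroup K) [Fact (κ.IsTopGenerator γ)]
    [TopologicalSpace (IwasawaAlgebra p)]
    [ContinuousSMul (IwasawaAlgebra p) (BigRepModule ℤ_[p] p (PrimaryTorsion (geomPoints (W.baseChange K)) p))] :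
    Nonempty (AcSelmer.XAc (W.baseChange K) p κ 𝔮 S γ ≃ₗ[IwasawaAlgebra p]
      XBig κ ((W.baseChange K).primaryTorsionGaloisRep p) 𝔮 S) := by
  obtain ⟨e⟩ := hSh W p (by omega) K hK hsplit 𝔮 h𝔮 S hS hSp κ hκ γ
  have hEq := hSig W p hp hirr K hK hsplit 𝔮 h𝔮 S hS hSp hram κ hκ
  -- `XBig = CharacterModule selmerBig`, `XBigDecomp = CharacterModule selmerBigDecomp`, and the submodules are equal
  have f : XBigDecomp κ ((W.baseChange K).primaryTorsionGaloisRep p) 𝔮 S ≃ₗ[IwasawaAlgebra p]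
      XBig κ ((W.baseChange K).primaryTorsionGaloisRep p) 𝔮 S :=
    CharacterModule.congr (LinearEquiv.ofEq _ _ hEq.symm)
  exact ⟨e.trans f⟩

end Summit.BirchSwinnertonDyer.Rank1Residual.X11b.RoadFFMember

end
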